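import Summits.PneNP.PneNP.Theorems.ExpanderLinearGeneratorsLinearGeneratorModPFregeHardNotPolyBounded
import Summits.PneNP.PneNP.Theorems.ExpanderLinearGeneratorsLinearGeneratorModPFregeHardMod2Easy
import Summits.PneNP.PneNP.Theorems.ExpanderLinearGeneratorsLinearGeneratorModPFregeHardMod2Prelim
import Summits.PneNP.PneNP.Theorems.ExpanderLinearGeneratorsExpansionForcesDepthFregeSizeEightReduction
import Literature.Computability.MetaComplexity.GaussianWidth
import HarnessLib

/-!
# `F(MOD₂)` IS polynomially bounded on the Margulis–Tseitin tautologies: the modulus dichotomy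
of `LinearGeneratorModPFregeHard` in the vocabulary of Problem 15.6.1 (item stmt-PneNP-11444)

Support file for item `stmt-PneNP-11444` (`LinearGeneratorModPFregeHard`).  Companion of
`…ModPFregeHardNotPolyBounded.lean` (under the crux, for every ODD prime `p` and every depth `d`,
`textbookFrege_d(MOD_p)` is not polynomially bounded on the explicit class
`margulisTseitinTargets`).  Here the other side: at `p = 2` some fixed depth `d₀` IS polynomially
bounded on that class (`isModDepthPolyBoundedOn_two_margulisTseitinTargets`), by the
polynomial-size `MOD₂` refutations of `…Mod2Easy.lean` — once their size bound, polynomial in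
`|ofCNF φ| + m + n`, is turned into a polynomial in the size of the target alone:

* `radius_lt_card_of_unsat` — an unsolvable system whose supports form an `(r, c)`-boundary
  expander (`c > 0`) has MORE THAN `r` rows: a dual certificate `Σ_{i ∈ F} Eᵢ = (0 = 1)` has
  empty boundary, so expansion forces `|F| > r`;
* `numVars_le_pow_card` — hence on the class (`r = n^(1/200)`) the number of variables is
  `n ≤ m^200`, and `m ≤ #clauses ≤ |φ|`, so `|ofCNF φ| + m + n + 2 ≤ 4 |φ|^200`;
* `isModDepthPolyBoundedOn_two_margulisTseitinTargets` and the combined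
  `margulisTseitin_modulus_dichotomy`: `(∃ d₀, PolyBounded 2 d₀ T) ∧ (crux → ∀ odd p, ∀ d,
  ¬ PolyBounded p d T)` for `T = margulisTseitinTargets`.

References: J. Krajíček, *Proof Complexity* (CUP 2019), §15.6, Problem 15.6.1
[KrajicekProofComplexity2019]; S. Buss et al., Comput. Complexity 6 (1996/97), Def. 1.1
[BussImpagliazzoKrajicekPudlakRazborovSgall1997].
-/

noncomputable section

set_option linter.dupNamespace false -- `Summit.PneNP.PneNP.…`: summit = sub-problem (D-0017)

namespace Summit.PneNP.PneNP.Theorems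

open Literature.Computability.Complexity Literature.Computability.MetaComplexity
open Summit.PneNP.PneNP.Theses.ExpanderLinearGenerators

/-! ### Unsolvable expanding systems have more than `r` rows -/

/-- Over `𝔽₂`, a linear combination is the row-sum over the support of its coefficient vector.
[folklore] -/
theorem lincomb_eq_rowComb_vsupp {m n : ℕ} (v : Fin m → ZMod 2) (E : Fin m → LinEqMod 2 n) :
    lincomb v E = rowComb E (vsupp v) := by
  rw [rowComb_def]
  congr 1
  funext i
  by_cases h : v i = 0
  · simp [vsupp, h]
  · have h1 : v i = 1 := by revert h; generalize v i = a; revert a; decide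
    simp [vsupp, h1]

/-- **An unsolvable system with `(r, c)`-boundary-expanding supports (`c > 0`) has more than `r`
rows.** The support `F` of a dual certificate `Σ vᵢ Eᵢ = (0 = 1)` (`exists_lincomb_eq_zero_one`)
has a row-sum without variables, hence empty boundary (`card_boundary_le_card_supp_rowComb`);
if `|F| ≤ r` expansion would give `c |F| ≤ 0`, i.e. `F = ∅`, but the empty row-sum is `0 = 0`.
[Ben-Sasson–Wigderson 2001, §5 (boundary of a contradiction); folklore] -/
theorem radius_lt_card_of_unsat {m n : ℕ} (E : Fin m → LinEqMod 2 n) {r c : ℝ}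
    (hexp : IsBoundaryExpander (fun i => (E i).supp.map Fin.valEmbedding) r c) (hc : 0 < c)
    (hE : ¬ SystemSat E Finset.univ) : r < m := by
  have hne01 : (0 : ZMod 2) ≠ 1 := by decide
  haveI : Fact (Nat.Prime 2) := ⟨Nat.prime_two⟩
  obtain ⟨v, hv⟩ := exists_lincomb_eq_zero_one E hE
  set F := vsupp v with hF
  have hcomb : rowComb E F = (0, 1) := by rw [hF, ← lincomb_eq_rowComb_vsupp, hv]
  by_contra hle
  push Not at hle
  have hFm : F.card ≤ m := (Finset.card_le_univ F).trans_eq (Fintype.card_fin m)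
  have hFr : (F.card : ℝ) ≤ r := le_trans (by exact_mod_cast hFm) hle
  have hbd := card_boundary_le_card_supp_rowComb E F
  rw [hcomb, show LinEqMod.supp ((0, 1) : LinEqMod 2 n) = ∅ from
    LinEqMod.supp_eq_empty_iff.2 rfl, Finset.card_empty] at hbd
  have h0 : c * F.card ≤ 0 := by
    have := hexp F hFr
    have hbd' : ((boundary (fun i => (E i).supp.map Fin.valEmbedding) F).card : ℝ) ≤ 0 := by
      exact_mod_cast hbd
    linarith
  have hFempty : F = ∅ := by
    have : (F.card : ℝ) ≤ 0 := by
      by_contra hpos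
      push Not at hpos
      have := mul_pos hc hpos
      linarith
    have hc0 : F.card = 0 := by exact_mod_cast le_antisymm this (Nat.cast_nonneg _)
    exact Finset.card_eq_zero.1 hc0
  rw [hFempty, rowComb_empty] at hcomb
  have h01 : ((0 : LinEqMod 2 n)).2 = 1 := by rw [hcomb]
  simp only [Prod.snd_zero] at h01
  exact hne01 h01

/-! ### Size parameters of the members of the class -/

/-- **On the class, the number of variables is polynomial in the number of rows**: `n ≤ m^200`
(the radius `n^(1/200)` is below `m` by `radius_lt_card_of_unsat`). [folklore] -/
theorem numVars_le_pow_card {n m : ℕ} (E : Fin m → LinEqMod 2 n)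
    (hexp : IsBoundaryExpander (fun i => (E i).supp.map Fin.valEmbedding)
      ((n : ℝ) ^ (1 - (199 / 200 : ℝ))) (3 / 4 * ((16 : ℕ) : ℝ)))
    (hE : ¬ SystemSat E Finset.univ) : n ≤ m ^ 200 := by
  have hr := radius_lt_card_of_unsat E hexp (by norm_num) hE
  have hn0 : (0 : ℝ) ≤ n := Nat.cast_nonneg n
  have hpow : (n : ℝ) = ((n : ℝ) ^ (1 - (199 / 200 : ℝ))) ^ (200 : ℕ) := by
    rw [← Real.rpow_natCast, ← Real.rpow_mul hn0]
    norm_num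
  have hlt : (n : ℝ) < (m : ℝ) ^ (200 : ℕ) := by
    rw [hpow]
    exact pow_lt_pow_left₀ hr (Real.rpow_nonneg hn0 _) (by norm_num)
  exact_mod_cast hlt.le

/-- **The size parameter of `…Mod2Easy` is polynomial in the target size**: for a member of the
class with target `φ = ¬ ofCNF (sumEncoding 1 E)`,
`|ofCNF (sumEncoding 1 E)| + m + n + 2 ≤ 4 · |φ|^200`. [folklore] -/
theorem param_le_size_pow {n m : ℕ} (E : Fin m → LinEqMod 2 n) (hn : 2 ^ 200 ≤ n)
    (hexp : IsBoundaryExpander (fun i => (E i).supp.map Fin.valEmbedding)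
      ((n : ℝ) ^ (1 - (199 / 200 : ℝ))) (3 / 4 * ((16 : ℕ) : ℝ)))
    (hE : ¬ SystemSat E Finset.univ) :
    (PropForm.ofCNF (sumEncoding 1 E)).size + m + n + 2 ≤
      4 * (PropForm.neg (PropForm.ofCNF (sumEncoding 1 E))).size ^ 200 := by
  set S₀ := (PropForm.ofCNF (sumEncoding 1 E)).size with hS₀
  have hS : (PropForm.neg (PropForm.ofCNF (sumEncoding 1 E))).size = S₀ + 1 := by
    rw [PropForm.size]
  -- `m ≤ #clauses ≤ S₀`
  have hne : ∀ i, (E i).supp.Nonempty := by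
    intro i
    have h := le_card_supp_of_expander E (ℓ := 16) (le_trans (by norm_num) (two_le_radius hn)) hexp i
    have h' : (0 : ℝ) < (E i).supp.card := lt_of_lt_of_le (by norm_num) h
    exact Finset.card_pos.1 (by exact_mod_cast h')
  have hm : m ≤ S₀ := (card_le_length_sumEncoding E hne).trans (ModTwo.length_le_size_ofCNF _)
  -- `n ≤ m^200 ≤ S₀^200`
  have hnm : n ≤ S₀ ^ 200 := (numVars_le_pow_card E hexp hE).trans (Nat.pow_le_pow_left hm 200)
  rw [hS]
  have h1 : S₀ ≤ (S₀ + 1) ^ 200 :=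
    (Nat.le_succ S₀).trans (by
      calc S₀ + 1 = (S₀ + 1) ^ 1 := (pow_one _).symm
        _ ≤ (S₀ + 1) ^ 200 := Nat.pow_le_pow_right (Nat.succ_pos _) (by norm_num))
  have h2 : S₀ ^ 200 ≤ (S₀ + 1) ^ 200 := Nat.pow_le_pow_left (Nat.le_succ _) 200
  have h3 : 2 ≤ (S₀ + 1) ^ 200 := by
    calc 2 ≤ 2 ^ 1 := by norm_num
      _ ≤ (S₀ + 1) ^ 1 := Nat.pow_le_pow_left (by have := PropForm.size_pos (PropForm.ofCNF (sumEncoding 1 E)); omega) 1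
      _ ≤ (S₀ + 1) ^ 200 := Nat.pow_le_pow_right (Nat.succ_pos _) (by norm_num)
  omega

/-! ### Polynomial boundedness at `p = 2`, and the dichotomy -/

/-- **`textbookFrege(MOD₂)` of some fixed depth is polynomially bounded on the Margulis–Tseitin
tautologies**: the depth-`d₀` `MOD₂` refutations of `ModTwo.exists_modTwo_refutation` (summing
the certificate rows with `MOD₂` gates) have size `≤ (|ofCNF φ| + m + n + 2)^c ≤ (4|φ|^200)^c`,
a polynomial in the size of the target. [Buss et al. 1997, Def. 1.1; Krajíček 2019, §15.6
("for `p = 2` the XOR systems are easy")] [folklore] -/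
theorem isModDepthPolyBoundedOn_two_margulisTseitinTargets :
    ∃ d₀ : ℕ, textbookFrege.IsModDepthPolyBoundedOn 2 d₀ margulisTseitinTargets := by
  obtain ⟨d₀, c, href⟩ := ModTwo.exists_modTwo_refutation
  refine ⟨d₀, Polynomial.C (4 ^ c) * Polynomial.X ^ (200 * c), fun φ hφ _ => ?_⟩
  obtain ⟨n, m, E, hn, -, hexp, hE, rfl⟩ := hφ
  obtain ⟨π, hπ, hsize⟩ := href n m E hE
  refine ⟨π, hπ, hsize.trans ?_⟩
  rw [Polynomial.eval_mul, Polynomial.eval_C, Polynomial.eval_pow, Polynomial.eval_X, pow_mul,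
    ← Nat.mul_pow]
  exact Nat.pow_le_pow_left (param_le_size_pow E hn hexp hE) c

/-- **The modulus dichotomy of the crux in the vocabulary of Problem 15.6.1.** On the explicit
class `T` of Margulis–Tseitin tautologies: (i) `textbookFrege_{d₀}(MOD₂)` is polynomially
bounded on `T` for some depth `d₀` (unconditionally); (ii) if `LinearGeneratorModPFregeHard`
holds then for every odd prime `p` and EVERY depth `d`, `textbookFrege_d(MOD_p)` is not
polynomially bounded on `T`. [cite: KrajicekProofComplexity2019, Problem 15.6.1] -/
theorem margulisTseitin_modulus_dichotomy :
    (∃ d₀ : ℕ, textbookFrege.IsModDepthPolyBoundedOn 2 d₀ margulisTseitinTargets) ∧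
      (LinearGeneratorModPFregeHard → ∀ p : ℕ, p.Prime → p ≠ 2 → ∀ d : ℕ,
        ¬ textbookFrege.IsModDepthPolyBoundedOn p d margulisTseitinTargets) :=
  ⟨isModDepthPolyBoundedOn_two_margulisTseitinTargets,
    fun h p hp hp2 d => not_isModDepthPolyBoundedOn_of_linearGeneratorModPFregeHard h p hp hp2 d⟩

end Summit.PneNP.PneNP.Theorems
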